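import Mathlib.RepresentationTheory.Basic
import HarnessLib

/-!
# Semi-invariant operators define a character
(crux stmt-Langlands-14329 `IrreducibilityBySelfDuality.IrreducibleOffSector`, line `Sketch`;
stub `exists_character_of_semiInvariant` (W2) of the base-change ascent package, lead c7)

Let `π : G →* End_k(V)` be a representation of a group `G` on a `k`-vector space `V` and let
`T : V →ₗ[k] V` be a **non-zero semi-invariant operator**: for every `g : G` there is a scalar
`c_g : k` with `π(g) ∘ T = c_g • (T ∘ π(g))`.  Then the scalars `c_g` are uniquely determined and
`g ↦ c_g` is a character `χ : G →* kˣ`.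

This is the elementary step of Clifford's dichotomy used in the Galois core of the base-change
ascent closure operator for the crux "cuspidal ⇒ irreducible": a semi-invariant `T` is then an
isomorphism `π ≅ π ⊗ χ⁻¹`.

Proof.  Since `π(g)` is invertible (`π(g⁻¹) ∘ π(g) = π(1) = id`), `T ∘ π(g) ≠ 0` and
`π(g) ∘ T ≠ 0`; hence the scalar in `π(g) ∘ T = c • (T ∘ π(g))` is unique (`smul_eq_zero`) and
non-zero.  Multiplicativity: `π(gh) ∘ T = π(g) ∘ (c_h • T ∘ π(h)) = c_h c_g • (T ∘ π(g) ∘ π(h))`,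
and uniqueness gives `c_{gh} = c_g c_h`.  Package with `MonoidHom.mk'` and `Units.mk0`.
-/

noncomputable section

-- `Summit.Langlands.Langlands.…` (summit = sub-problem name, D-0017 layout) trips `dupNamespace`.
set_option linter.dupNamespace false

namespace Summit.Langlands.Langlands.Theorems.IrreducibleOffSector

/-- For a representation `π` of a group, `π g⁻¹ ∘ₗ π g = id`. [folklore] -/
theorem rep_inv_comp_self {k : Type*} [Field k] {G : Type*} [Group G]
    {V : Type*} [AddCommGroup V] [Module k V] (π : Representation k G V) (g : G) :
    π g⁻¹ ∘ₗ π g = LinearMap.id := by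
  rw [← Module.End.mul_eq_comp, ← map_mul, inv_mul_cancel, map_one, Module.End.one_eq_id]

/-- For a representation `π` of a group, `π g ∘ₗ π g⁻¹ = id`. [folklore] -/
theorem rep_self_comp_inv {k : Type*} [Field k] {G : Type*} [Group G]
    {V : Type*} [AddCommGroup V] [Module k V] (π : Representation k G V) (g : G) :
    π g ∘ₗ π g⁻¹ = LinearMap.id := by
  rw [← Module.End.mul_eq_comp, ← map_mul, mul_inv_cancel, map_one, Module.End.one_eq_id]

/-- If `T ≠ 0` then `T ∘ₗ π g ≠ 0` for every `g` (as `π g` is invertible). [folklore] -/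
theorem comp_rep_ne_zero {k : Type*} [Field k] {G : Type*} [Group G]
    {V : Type*} [AddCommGroup V] [Module k V] (π : Representation k G V) {T : V →ₗ[k] V}
    (hT : T ≠ 0) (g : G) : T ∘ₗ π g ≠ 0 := by
  intro hg
  apply hT
  calc T = (T ∘ₗ π g) ∘ₗ π g⁻¹ := by
          rw [LinearMap.comp_assoc, rep_self_comp_inv, LinearMap.comp_id]
    _ = 0 := by rw [hg, LinearMap.zero_comp]

/-- If `T ≠ 0` then `π g ∘ₗ T ≠ 0` for every `g` (as `π g` is invertible). [folklore] -/
theorem rep_comp_ne_zero {k : Type*} [Field k] {G : Type*} [Group G]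
    {V : Type*} [AddCommGroup V] [Module k V] (π : Representation k G V) {T : V →ₗ[k] V}
    (hT : T ≠ 0) (g : G) : π g ∘ₗ T ≠ 0 := by
  intro hg
  apply hT
  calc T = π g⁻¹ ∘ₗ (π g ∘ₗ T) := by
          rw [← LinearMap.comp_assoc, rep_inv_comp_self, LinearMap.id_comp]
    _ = 0 := by rw [hg, LinearMap.comp_zero]

/-- Uniqueness of the semi-invariance scalar: if `T ≠ 0` and
`π g ∘ₗ T = c • (T ∘ₗ π g) = c' • (T ∘ₗ π g)` then `c = c'`. [folklore] -/
theorem semiInvariant_scalar_unique {k : Type*} [Field k] {G : Type*} [Group G]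
    {V : Type*} [AddCommGroup V] [Module k V] (π : Representation k G V) {T : V →ₗ[k] V}
    (hT : T ≠ 0) {g : G} {c c' : k} (hc : π g ∘ₗ T = c • (T ∘ₗ π g))
    (hc' : π g ∘ₗ T = c' • (T ∘ₗ π g)) : c = c' := by
  rw [hc] at hc'
  have h0 : (c - c') • (T ∘ₗ π g) = 0 := by rw [sub_smul, hc', sub_self]
  rcases smul_eq_zero.mp h0 with h1 | h1
  · exact sub_eq_zero.mp h1
  · exact absurd h1 (comp_rep_ne_zero π hT g)

/-- **Semi-invariant operators define a character** (registered stub W2, line `Sketch`,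
crux stmt-Langlands-14329).  If `T ≠ 0` and for every `g` there is `c : k` with
`π g ∘ₗ T = c • (T ∘ₗ π g)`, then there is a character `χ : G →* kˣ` with
`π g ∘ₗ T = χ g • (T ∘ₗ π g)` for all `g`, and the scalar is unique. [folklore] -/
theorem exists_character_of_semiInvariant {k : Type*} [Field k] {G : Type*} [Group G]
    {V : Type*} [AddCommGroup V] [Module k V] (π : Representation k G V) (T : V →ₗ[k] V)
    (hT : T ≠ 0) (h : ∀ g : G, ∃ c : k, π g ∘ₗ T = c • (T ∘ₗ π g)) :
    ∃ χ : G →* kˣ, ∀ g : G, π g ∘ₗ T = ((χ g : kˣ) : k) • (T ∘ₗ π g) ∧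
      ∀ c : k, π g ∘ₗ T = c • (T ∘ₗ π g) → c = χ g := by
  choose c hc using h
  -- the scalars are non-zero
  have hc0 : ∀ g, c g ≠ 0 := by
    intro g hg
    apply rep_comp_ne_zero π hT g
    rw [hc g, hg, zero_smul]
  -- multiplicativity
  have hmul : ∀ a b, c (a * b) = c a * c b := by
    intro a b
    refine semiInvariant_scalar_unique π hT (hc (a * b)) ?_
    calc π (a * b) ∘ₗ T = π a ∘ₗ (π b ∘ₗ T) := by
            rw [map_mul, Module.End.mul_eq_comp, LinearMap.comp_assoc]
      _ = c b • ((π a ∘ₗ T) ∘ₗ π b) := by rw [hc b, LinearMap.comp_smul, LinearMap.comp_assoc]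
      _ = c b • (c a • ((T ∘ₗ π a) ∘ₗ π b)) := by rw [hc a, LinearMap.smul_comp]
      _ = (c a * c b) • (T ∘ₗ π (a * b)) := by
            rw [smul_smul, mul_comm, map_mul, Module.End.mul_eq_comp, LinearMap.comp_assoc]
  refine ⟨MonoidHom.mk' (fun g => Units.mk0 (c g) (hc0 g)) (fun a b => Units.ext (hmul a b)),
    fun g => ⟨hc g, fun c' hc' => semiInvariant_scalar_unique π hT hc' (hc g)⟩⟩

end Summit.Langlands.Langlands.Theorems.IrreducibleOffSector

end
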